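import Mathlib.NumberTheory.Padics.PadicNorm
import Mathlib.LinearAlgebra.Matrix.Determinant.Basic
import Mathlib.LinearAlgebra.Matrix.NonsingularInverse
import HarnessLib

/-!
# Brown, *Mixed Tate motives over ℤ* (2012) — the elementary lemmas: §7.1, the `p`-adic lemma

Sibling proof file in the cone of the named fact
`Literature.NumberTheory.Transcendental.hoffmanSpan_eq_mzvSpace` (Brown 2012, Theorem 1.1: the
Hoffman elements span the multiple zeta values), vendoring the steps of Brown's printed proof that
are elementary (free of mixed Tate motives) as proved theorems. This file: the linear-algebra
input of the proof of the main theorem,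

* `Brown2012.det_ne_zero_of_padicNorm`, `Brown2012.lemma_7_1` — **Lemma 7.1** (`p`-adic lemma):
  a square matrix `A = (aᵢⱼ)` over `ℚ` with `v_p(aᵢⱼ) ≥ 1` for `i > j` and
  `v_p(aⱼⱼ) = minᵢ v_p(aᵢⱼ) ≤ 0` for all `j` is invertible

(used in Theorem 7.3 with `p = 2` for the matrices `M_{N,ℓ}` of the level-lowering operators
`∂_{N,ℓ}`, whence the linear independence of the motivic Hoffman elements, Theorem 7.4).
The proof is Brown's: in the Leibniz expansion of `det A` the diagonal monomial has valuation
`∑ v_p(aᵢᵢ) ≤ 0` and every other monomial has strictly larger valuation (it contains a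
subdiagonal entry, of valuation `≥ 1`, and its other entries are dominated column-wise by the
diagonal ones), so `v_p(det A) = ∑ᵢ v_p(aᵢᵢ) < ∞`. We phrase valuations through the `p`-adic
absolute value `padicNorm p` (`|x|_p = p^{-v_p(x)}`, `|0|_p = 0`, which builds in Brown's
convention `v_p(0) = ∞`), and also give the statement with `padicValRat` as printed.

No definitions and no named facts are introduced (pure proofs, D-0026).

## References

* F. Brown, *Mixed Tate motives over ℤ*, Ann. of Math. **175** (2012), 949–976, §7.1 Lemma 7.1,
  Remark 7.2, Theorem 7.3 (arXiv:1102.1312, pp. 17–18). [Brown2012]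
-/

namespace Literature.NumberTheory.Transcendental

namespace Brown2012

open Finset

/-- The `p`-adic absolute value of a finite product. [folklore] -/
theorem padicNorm_prod {ι : Type*} (p : ℕ) [Fact p.Prime] (s : Finset ι) (f : ι → ℚ) :
    padicNorm p (∏ i ∈ s, f i) = ∏ i ∈ s, padicNorm p (f i) := by
  induction s using Finset.cons_induction with
  | empty => simp
  | cons a s ha ih => rw [Finset.prod_cons, Finset.prod_cons, padicNorm.mul, ih]

/-- A permutation of a finite linear order other than the identity moves some element up:
`σ ≠ 1 → ∃ i, i < σ i` (the least non-fixed point is moved up). [folklore] -/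
theorem exists_lt_apply_of_ne_one {n : Type*} [LinearOrder n] [Fintype n] {σ : Equiv.Perm n}
    (hσ : σ ≠ 1) : ∃ i, i < σ i := by
  classical
  by_contra h
  push Not at h
  have hS : (Finset.univ.filter fun i => σ i ≠ i).Nonempty := by
    by_contra h'
    rw [Finset.not_nonempty_iff_eq_empty, Finset.filter_eq_empty_iff] at h'
    exact hσ (Equiv.ext fun i => by simpa using h' (Finset.mem_univ i))
  obtain ⟨hi₁, hi₂⟩ := Finset.mem_filter.mp (Finset.min'_mem _ hS)
  set i := (Finset.univ.filter fun i => σ i ≠ i).min' hS with hi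
  have hlt : σ i < i := lt_of_le_of_ne (h i) hi₂
  have hfix : σ (σ i) = σ i := by
    by_contra hne
    have hmem : σ i ∈ Finset.univ.filter fun i => σ i ≠ i :=
      Finset.mem_filter.mpr ⟨Finset.mem_univ _, hne⟩
    have hle : i ≤ σ i := by rw [hi]; exact Finset.min'_le _ _ hmem
    exact absurd hlt (not_lt.mpr hle)
  exact hi₂ (σ.injective hfix)

/-- **Brown 2012, Lemma 7.1** (`p`-adic lemma), in terms of the `p`-adic absolute value: let `A` be a
square matrix over `ℚ` (rows and columns indexed by a finite linear order) such that
(i) `|aᵢⱼ|_p < 1` for all `i > j` (i.e. `v_p(aᵢⱼ) ≥ 1`), and (ii) `|aᵢⱼ|_p ≤ |aⱼⱼ|_p` for all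
`i, j` and `|aⱼⱼ|_p ≥ 1` for all `j` (i.e. `v_p(aⱼⱼ) = minᵢ v_p(aᵢⱼ) ≤ 0`). Then `det A ≠ 0`:
indeed `|det A|_p = ∏ⱼ |aⱼⱼ|_p`, every non-diagonal monomial of the Leibniz expansion having
strictly smaller absolute value. [cite: Brown2012, Lemma 7.1] -/
theorem det_ne_zero_of_padicNorm {n : Type*} [LinearOrder n] [Fintype n] [DecidableEq n]
    (p : ℕ) [Fact p.Prime] (A : Matrix n n ℚ)
    (h1 : ∀ i j, j < i → padicNorm p (A i j) < 1)
    (h2 : ∀ i j, padicNorm p (A i j) ≤ padicNorm p (A j j))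
    (h3 : ∀ j, 1 ≤ padicNorm p (A j j)) : A.det ≠ 0 := by
  classical
  -- the diagonal monomial `m₀ = ∏ aᵢᵢ` has `|m₀|_p ≥ 1`
  set m₀ : ℚ := ∏ i, A i i with hm₀
  have hm₀_norm : padicNorm p m₀ = ∏ i, padicNorm p (A i i) := padicNorm_prod p _ _
  have hdiag_ge : (1 : ℚ) ≤ ∏ i, padicNorm p (A i i) := by
    have h := Finset.prod_le_prod (s := Finset.univ) (f := fun _ => (1 : ℚ)) (g := fun i => padicNorm p (A i i))
      (fun _ _ => zero_le_one) (fun i _ => h3 i)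
    simpa using h
  have hm₀_ge : 1 ≤ padicNorm p m₀ := hm₀_norm ▸ hdiag_ge
  -- every other monomial is strictly smaller
  have hlt : ∀ σ : Equiv.Perm n, σ ≠ 1 →
      padicNorm p (Equiv.Perm.sign σ • ∏ i, A (σ i) i) < padicNorm p m₀ := by
    intro σ hσ
    have hsign : padicNorm p (Equiv.Perm.sign σ • ∏ i, A (σ i) i) =
        padicNorm p (∏ i, A (σ i) i) := by
      rcases Int.units_eq_one_or (Equiv.Perm.sign σ) with h | h <;> rw [h]
      · rw [one_smul]
      · rw [Units.neg_smul, one_smul, padicNorm.neg]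
    rw [hsign, padicNorm_prod, hm₀_norm]
    obtain ⟨i₀, hi₀⟩ := exists_lt_apply_of_ne_one hσ
    by_cases hz : ∃ i, A (σ i) i = 0
    · obtain ⟨i, hi⟩ := hz
      rw [Finset.prod_eq_zero (Finset.mem_univ i) (by rw [hi, padicNorm.zero])]
      exact lt_of_lt_of_le zero_lt_one hdiag_ge
    · push Not at hz
      exact Finset.prod_lt_prod
        (fun i _ => lt_of_le_of_ne (padicNorm.nonneg _) (padicNorm.nonzero (hz i)).symm)
        (fun i _ => h2 (σ i) i)
        ⟨i₀, Finset.mem_univ _, lt_of_lt_of_le (h1 (σ i₀) i₀ hi₀) (h3 i₀)⟩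
  -- hence `|det A|_p = |m₀|_p ≥ 1`
  have hsplit : A.det = m₀ + ∑ σ ∈ Finset.univ.erase 1, Equiv.Perm.sign σ • ∏ i, A (σ i) i := by
    rw [Matrix.det_apply, ← Finset.add_sum_erase _ _ (Finset.mem_univ (1 : Equiv.Perm n))]
    simp [hm₀]
  have hrest : padicNorm p (∑ σ ∈ Finset.univ.erase 1, Equiv.Perm.sign σ • ∏ i, A (σ i) i) <
      padicNorm p m₀ :=
    padicNorm.sum_lt' (fun σ hσ => hlt σ (Finset.ne_of_mem_erase hσ))
      (lt_of_lt_of_le zero_lt_one hm₀_ge)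
  intro hdet
  have hmax := padicNorm.add_eq_max_of_ne (p := p) (ne_of_gt hrest)
  rw [← hsplit, hdet, padicNorm.zero, max_eq_left hrest.le] at hmax
  linarith

/-- **Brown 2012, Lemma 7.1** (`p`-adic lemma) as printed, with `p`-adic valuations
(`v_p = padicValRat p`; zero entries, `v_p(0) = ∞`, are allowed where the printed hypothesis is an
inequality `v_p ≥ ·`): let `p` be a prime and `A = (aᵢⱼ)` a square matrix with rational
coefficients such that (i) `v_p(aᵢⱼ) ≥ 1` for all `i > j`, and (ii) `v_p(aⱼⱼ) = minᵢ v_p(aᵢⱼ) ≤ 0`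
for all `j` (so `aⱼⱼ ≠ 0`, `v_p(aⱼⱼ) ≤ 0`, and `v_p(aⱼⱼ) ≤ v_p(aᵢⱼ)` whenever `aᵢⱼ ≠ 0`).
Then `A` is invertible. [cite: Brown2012, Lemma 7.1] -/
theorem lemma_7_1 {n : Type*} [LinearOrder n] [Fintype n] [DecidableEq n] (p : ℕ) [Fact p.Prime]
    (A : Matrix n n ℚ)
    (h1 : ∀ i j, j < i → A i j = 0 ∨ 1 ≤ padicValRat p (A i j))
    (h2 : ∀ i j, A i j = 0 ∨ padicValRat p (A j j) ≤ padicValRat p (A i j))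
    (h3 : ∀ j, A j j ≠ 0 ∧ padicValRat p (A j j) ≤ 0) : IsUnit A := by
  rw [Matrix.isUnit_iff_isUnit_det, isUnit_iff_ne_zero]
  have hp : (1 : ℚ) < p := by exact_mod_cast (Fact.out : p.Prime).one_lt
  refine det_ne_zero_of_padicNorm p A (fun i j hij => ?_) (fun i j => ?_) (fun j => ?_)
  · rcases h1 i j hij with h | h
    · rw [h, padicNorm.zero]; exact zero_lt_one
    · by_cases hz : A i j = 0
      · rw [hz, padicNorm.zero]; exact zero_lt_one
      · rw [padicNorm.eq_zpow_of_nonzero hz]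
        exact zpow_lt_one_of_neg₀ hp (by linarith)
  · rcases h2 i j with h | h
    · rw [h, padicNorm.zero]; exact padicNorm.nonneg _
    · by_cases hz : A i j = 0
      · rw [hz, padicNorm.zero]; exact padicNorm.nonneg _
      · rw [padicNorm.eq_zpow_of_nonzero hz, padicNorm.eq_zpow_of_nonzero (h3 j).1]
        exact zpow_le_zpow_right₀ hp.le (by linarith)
  · rw [padicNorm.eq_zpow_of_nonzero (h3 j).1]
    exact one_le_zpow₀ hp.le (by linarith [(h3 j).2])

/-- The determinant form of Lemma 7.1 with valuations: under the printed hypotheses,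
`det A ≠ 0`. [cite: Brown2012, Lemma 7.1] -/
theorem lemma_7_1_det_ne_zero {n : Type*} [LinearOrder n] [Fintype n] [DecidableEq n] (p : ℕ)
    [Fact p.Prime] (A : Matrix n n ℚ)
    (h1 : ∀ i j, j < i → A i j = 0 ∨ 1 ≤ padicValRat p (A i j))
    (h2 : ∀ i j, A i j = 0 ∨ padicValRat p (A j j) ≤ padicValRat p (A i j))
    (h3 : ∀ j, A j j ≠ 0 ∧ padicValRat p (A j j) ≤ 0) : A.det ≠ 0 := by
  have h := lemma_7_1 p A h1 h2 h3
  rw [Matrix.isUnit_iff_isUnit_det, isUnit_iff_ne_zero] at h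
  exact h

end Brown2012

end Literature.NumberTheory.Transcendental
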